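import Mathlib.Tactic.DeriveFintype
import Literature.Computability.Complexity.Transducers
import Literature.Computability.Complexity.PairingMachines
import Literature.Computability.Complexity.TimeBoundsProofs
import Literature.Computability.Cryptography.EncryptionSchemes
import HarnessLib

/-!
# Multiple-message indistinguishability implies single-message indistinguishability

Sibling proof file of `EncryptionSchemes.lean` (D-0014). It discharges the named fact
`Literature.Computability.Cryptography.SKEScheme.HasIndMultipleEncryptions.hasIndistinguishableEncryptions`:
for every private-key scheme `S`, `S.HasIndMultipleEncryptions → S.HasIndistinguishableEncryptions`
(`hasIndistinguishableEncryptions_holds`, axioms `propext`, `Classical.choice`, `Quot.sound`).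

Source: O. Goldreich, *Foundations of Cryptography II: Basic Applications*, CUP 2004, proof of
Thm. 5.2.11, first sentence ("Clearly, multiple-message security implies single-message security
as a special case") and §5.2.5.1 ("the single-message case can be easily obtained by setting the
polynomial `t` … to be identically 1"); the multiple-message notion is Def. 5.2.9.

## The argument in H21's model

The `t ≡ 1` instance of `HasIndMultipleEncryptions` is literally
`HasIndMultipleEncryptions.indistSingleton` (proved in `EncryptionSchemes.lean`): the ensembles
`n ↦ singletonCode (E_{G(1ⁿ)}(m_b n))`, `singletonCode c = listBool.encode [c] = ⟨1¹, ⟨c, ε⟩⟩`, are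
computationally indistinguishable. To conclude for the bare ciphertext ensembles one turns a PPT
distinguisher `D` of `⟨1ⁿ, c⟩` into a PPT distinguisher `D'` of `⟨1ⁿ, singletonCode c⟩` with the
same acceptance probabilities. In the textbook model `D' = D ∘ strip`. For H21's `RandAlg`
(`Randomized.lean`) the coin budget `coinLen : ℕ → ℕ` is an arbitrary polynomially bounded
function of the *input length*, and `|⟨1ⁿ, singletonCode c⟩| = 2n + 2|c| + 8` does not determine
`|⟨1ⁿ, c⟩| = 2n + 2 + |c|`, so no single `D'` reproduces `D`'s coin counts on all inputs (see the
section docstring in `EncryptionSchemes.lean`). The discharge below circumvents this by the usual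
"prove the contrapositive along a sparse set of security parameters" bookkeeping:

1. If `eavAdvantage S D m₀ m₁` is not negligible, there are `k`, `ε > 0` and infinitely many `n`
   with `nᵏ · adv(n) ≥ ε` (`Metric.tendsto_nhds`, `Filter.frequently_atTop`).
2. Ciphertext laws have finite support (finitely many keys and coin strings), so
   `|c| ≤ L(n)` on the supports at parameter `n` (`SKEScheme.exists_length_le_of_mem_support`).
3. Choose bad parameters `n₀ < n₁ < ⋯` so sparse that `nᵢ + L(nᵢ) < nᵢ₊₁` (`sparseSeq`). On the
   set `T = {nᵢ}` an input length `2n + 2|c| + 8` (`n ∈ T`, `|c| ≤ L n`) determines `n` and `|c|`,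
   hence the coin count `D.coinLen (2n + 2 + |c|)`; this defines the (non-computable, but
   polynomially bounded) budget of `D' = stripDist D T L`, whose `run` is `D.run` precomposed with
   the finite-state transduction `stripMap = stripFST.eval` (`⟨⟨1ⁿ, singletonCode c⟩, r⟩ ↦
   ⟨⟨1ⁿ, c⟩, r⟩`; polynomial time by `FST.polyTimeComputable_eval` (`Transducers.lean`),
   `polyTimeComputable_boolUnpair` (`PairingMachines.lean`) and `PolyTimeComputable.comp_holds`).
4. For `n ∈ T`, `D'` on `⟨1ⁿ, singletonCode c⟩` has exactly the output law of `D` on `⟨1ⁿ, c⟩`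
   (`stripDist_outputPMF`), so `multEavAdvantage S D' = eavAdvantage S D` on `T`, which is
   infinite: `D'` contradicts `HasIndMultipleEncryptions` (via `multEavAdvantage_singleton`).

## References

* O. Goldreich, *Foundations of Cryptography II: Basic Applications*, CUP 2004, Def. 5.2.9,
  Thm. 5.2.11 (proof, first sentence), §5.2.5.1.
* O. Goldreich, *Foundations of Cryptography I: Basic Tools*, CUP 2001, §3.2.2 (closure of
  computational indistinguishability under efficient maps).
* S. Arora, B. Barak, *Computational Complexity: A Modern Approach*, CUP 2009, §0.1 (pairing),
  §1.2–1.3 (machine constructions), §7.1 (probabilistic machines).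
-/

namespace Literature.Computability.Cryptography

open Filter Asymptotics _root_.Computability Complexity

/-! ### The stripping transducer `⟨⟨1ⁿ, ⟨1¹, ⟨c, ε⟩⟩⟩, r⟩ ↦ ⟨⟨1ⁿ, c⟩, r⟩` -/

/-- States of the stripping transducer (see `StripState.δ`): copy the leading `1`s (`lead`), copy
three more symbols (`c1`–`c3`, the rest of the doubled separator `0011`), skip eight symbols
(`s1`–`s8`, the doubled header `11110011` of `singletonCode`), un-double quadrupled bits
(`quad0`–`quad3`) until the doubled terminator `0011` (`term`), then copy the rest (`copy`).
[folklore] -/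
inductive StripState
  | lead
  | c1
  | c2
  | c3
  | s1
  | s2
  | s3
  | s4
  | s5
  | s6
  | s7
  | s8
  | quad0
  | quad1 (b : Bool)
  | quad2 (b : Bool)
  | quad3 (b : Bool)
  | term
  | copy
  deriving DecidableEq, Fintype

namespace StripState

/-- Transition/output function of the stripping transducer (next state, at most one output
symbol). On the input `1^{4n} 0011 11110011 quad(c) 0011 01 r = ⟨⟨1ⁿ, singletonCode c⟩, r⟩` it
outputs `1^{4n} 0011 double(c) 01 r = ⟨⟨1ⁿ, c⟩, r⟩` (`stripMap_boolPair`). [Arora–Barak 2009, §0.1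
(the pairing `⟨x, y⟩`: double the bits of `x`, separator `01`)] [cite: AroraBarak2009, §0.1] -/
def δ : StripState → Bool → StripState × Option Bool
  | lead, true => (lead, some true)
  | lead, false => (c1, some false)
  | c1, b => (c2, some b)
  | c2, b => (c3, some b)
  | c3, b => (s1, some b)
  | s1, _ => (s2, none)
  | s2, _ => (s3, none)
  | s3, _ => (s4, none)
  | s4, _ => (s5, none)
  | s5, _ => (s6, none)
  | s6, _ => (s7, none)
  | s7, _ => (s8, none)
  | s8, _ => (quad0, none)
  | quad0, b => (quad1 b, none)
  | quad1 b, b' => if b' = b then (quad2 b, none) else (copy, none)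
  | quad2 b, b' => if b' = b then (quad3 b, some b) else (term, none)
  | quad3 b, _ => (quad0, some b)
  | term, _ => (copy, none)
  | copy, b => (copy, some b)

/-- `δ quad0 b = (quad1 b, ·)`: remember the first bit of a quadruple. [folklore] -/
@[simp] theorem δ_quad0 (b : Bool) : δ quad0 b = (quad1 b, none) := rfl

/-- Second bit of a quadruple equal to the first: keep reading. [folklore] -/
@[simp] theorem δ_quad1_self (b : Bool) : δ (quad1 b) b = (quad2 b, none) := by
  cases b <;> rfl

/-- Third bit equal: emit the first output copy. [folklore] -/
@[simp] theorem δ_quad2_self (b : Bool) : δ (quad2 b) b = (quad3 b, some b) := by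
  cases b <;> rfl

/-- Fourth bit: emit the second output copy and start the next quadruple. [folklore] -/
@[simp] theorem δ_quad3 (b b' : Bool) : δ (quad3 b) b' = (quad0, some b) := rfl

/-- In state `copy` every symbol is copied. [folklore] -/
@[simp] theorem δ_copy (b : Bool) : δ copy b = (copy, some b) := rfl

end StripState

/-- The stripping transducer as a finite-state transducer in the sense of `Transducers.lean`
(`Literature.Computability.Complexity.FST`): initial state `lead`, transitions `StripState.δ` (output words of length
`≤ 1`), empty `front`, body always kept. [Hopcroft–Ullman 1979, §2.7 (Mealy machines);
Arora–Barak 2009, §0.1, §1.2] [cite: AroraBarak2009, §0.1] -/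
def stripFST : FST StripState Bool Bool where
  init := StripState.lead
  step s b := ((StripState.δ s b).1, (StripState.δ s b).2.toList)
  front _ := []
  keep _ := true

/-- The transition of `stripFST` is `StripState.δ` (output symbol as a word). [folklore] -/
@[simp] theorem stripFST_step (s : StripState) (b : Bool) :
    stripFST.step s b = ((StripState.δ s b).1, (StripState.δ s b).2.toList) :=
  rfl

/-- The stripping map: the transduction of `stripFST`.
[Arora–Barak 2009, §0.1, §1.2] [cite: AroraBarak2009, §0.1] -/
def stripMap : List Bool → List Bool :=
  stripFST.eval

/-- `stripMap w` is the body emitted by `stripFST` from state `lead` (empty `front`, body kept).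
[folklore] -/
theorem stripMap_eq (w : List Bool) : stripMap w = (stripFST.run StripState.lead w).2 := by
  simp [stripMap, FST.eval, stripFST]

/-- In state `copy` the transducer copies its input. [folklore] -/
@[simp] theorem stripFST_run_copy (w : List Bool) :
    (stripFST.run StripState.copy w).2 = w := by
  induction w with
  | nil => rfl
  | cons b w ih => simpa using ih

/-- In state `quad0` the doubled terminator `0011` is deleted and the rest is copied. [folklore] -/
theorem stripFST_run_term (w : List Bool) :
    (stripFST.run StripState.quad0 (false :: false :: true :: true :: w)).2 = w := by
  simp [StripState.δ]

/-- In state `quad0` a quadrupled string `quad(c) = double(double c)` is un-doubled to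
`double c`. [Arora–Barak 2009, §0.1] [cite: AroraBarak2009, §0.1] -/
theorem stripFST_run_quad (c w : List Bool) :
    (stripFST.run StripState.quad0
        (((c.flatMap fun b => [b, b]).flatMap fun b => [b, b]) ++ w)).2 =
      (c.flatMap fun b => [b, b]) ++ (stripFST.run StripState.quad0 w).2 := by
  induction c with
  | nil => rfl
  | cons b c ih => simp [ih]

/-- From state `lead`, the block `0011 s₁⋯s₈` is copied as `0011` and the eight header symbols
are skipped, ending in state `quad0`. [folklore] -/
theorem stripFST_run_block (s₁ s₂ s₃ s₄ s₅ s₆ s₇ s₈ : Bool) (w : List Bool) :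
    (stripFST.run StripState.lead
        (false :: false :: true :: true :: s₁ :: s₂ :: s₃ :: s₄ :: s₅ :: s₆ :: s₇ :: s₈ :: w)).2 =
      false :: false :: true :: true :: (stripFST.run StripState.quad0 w).2 := by
  simp [StripState.δ]

/-- From state `lead`, a leading `1` is copied. [folklore] -/
theorem stripFST_run_true (w : List Bool) :
    (stripFST.run StripState.lead (true :: w)).2 =
      true :: (stripFST.run StripState.lead w).2 :=
  rfl

/-- `⟨b :: x, y⟩ = b b ⟨x, y⟩` (definitional). [Arora–Barak 2009, §0.1] [cite: AroraBarak2009, §0.1] -/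
theorem boolPair_cons (b : Bool) (x y : List Bool) :
    boolPair (b :: x) y = b :: b :: boolPair x y :=
  rfl

/-- `⟨ε, y⟩ = 01 y` (definitional). [Arora–Barak 2009, §0.1] [cite: AroraBarak2009, §0.1] -/
theorem boolPair_nil (y : List Bool) : boolPair [] y = false :: true :: y :=
  rfl

/-- `⟨c, r⟩ = double(c) 01 r`. [Arora–Barak 2009, §0.1] [cite: AroraBarak2009, §0.1] -/
theorem boolPair_eq_append (c r : List Bool) :
    boolPair c r = (c.flatMap fun b => [b, b]) ++ (false :: true :: r) := by
  simp [boolPair, List.append_assoc]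

/-- `⟨⟨c, ε⟩, r⟩ = quad(c) 0011 01 r`. [Arora–Barak 2009, §0.1] [cite: AroraBarak2009, §0.1] -/
theorem boolPair_boolPair_nil (c r : List Bool) :
    boolPair (boolPair c []) r =
      ((c.flatMap fun b => [b, b]).flatMap fun b => [b, b]) ++
        (false :: false :: true :: true :: false :: true :: r) := by
  simp [boolPair, List.flatMap_append, List.append_assoc]

/-- **The stripping transducer strips the singleton wrapper**:
`stripMap ⟨⟨1ⁿ, singletonCode c⟩, r⟩ = ⟨⟨1ⁿ, c⟩, r⟩` for all `n`, `c`, `r`.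
[Arora–Barak 2009, §0.1; Goldreich 2004, §5.2.5.1 (`t ≡ 1`)] [cite: AroraBarak2009, §0.1] -/
theorem stripMap_boolPair (n : ℕ) (c r : List Bool) :
    stripMap (boolPair (boolPair (unaryEncodeNat n) (singletonCode c)) r) =
      boolPair (boolPair (unaryEncodeNat n) c) r := by
  rw [stripMap_eq]
  induction n with
  | zero =>
    rw [unaryEncodeNat, boolPair_nil, boolPair_nil, boolPair_cons, boolPair_cons,
      boolPair_cons, boolPair_cons, singletonCode_eq]
    rw [show unaryEncodeNat 1 = [true] from rfl, boolPair_cons, boolPair_nil, boolPair_cons,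
      boolPair_cons, boolPair_cons, boolPair_cons, boolPair_boolPair_nil,
      stripFST_run_block, stripFST_run_quad, stripFST_run_term, boolPair_eq_append c r]
  | succ n ih =>
    rw [unaryEncodeNat, boolPair_cons, boolPair_cons, boolPair_cons, boolPair_cons, boolPair_cons,
      boolPair_cons, stripFST_run_true, stripFST_run_true, stripFST_run_true, stripFST_run_true,
      ih]

/-- `stripMap` is polynomial-time computable (a finite-state transduction,
`FST.polyTimeComputable_eval`). [Arora–Barak 2009, §1.2–1.3] [cite: AroraBarak2009, §1.2] -/
theorem polyTimeComputable_stripMap :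
    PolyTimeComputable (id : List Bool → List Bool) (id : List Bool → List Bool) stripMap :=
  stripFST.polyTimeComputable_eval

/-! ### Output laws of randomized algorithms that agree on an input -/

/-- Two randomized algorithms with the same coin count and the same run function on given inputs
have the same output law there. [Arora–Barak 2009, §7.1 (the random variable `M(x)`)] [cite: AroraBarak2009, §7.1] -/
theorem randAlg_outputPMF_congr {α α' β : Type} (A : RandAlg α β) (A' : RandAlg α' β)
    (ea : α → List Bool) (ea' : α' → List Bool) (x : α) (x' : α')
    (hlen : A.coinLen (ea x).length = A'.coinLen (ea' x').length)
    (hrun : ∀ r, A.run x r = A'.run x' r) : A.outputPMF ea x = A'.outputPMF ea' x' := by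
  unfold RandAlg.outputPMF
  have key : ∀ k k' : ℕ, k = k' → ∀ f : List Bool → β,
      (PMF.uniformOfFintype (List.Vector Bool k)).map (fun r => f r.toList) =
        (PMF.uniformOfFintype (List.Vector Bool k')).map (fun r => f r.toList) := by
    rintro k _ rfl f
    rfl
  have hfun : (fun r : List.Vector Bool (A.coinLen (ea x).length) => A.run x r.toList) =
      fun r => A'.run x' r.toList :=
    funext fun r => hrun _
  rw [hfun]
  exact key _ _ hlen fun r => A'.run x' r

/-- `|1ⁿ| = n` for Mathlib's `unaryEncodeNat`. [folklore] -/
private theorem length_unaryEncodeNat_aux : ∀ n : ℕ, (unaryEncodeNat n).length = n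
  | 0 => rfl
  | n + 1 => by simp [unaryEncodeNat, length_unaryEncodeNat_aux n]

/-! ### The distinguisher `D'` along a sparse set of security parameters -/

section StripDist

variable (D : RandAlg (List Bool) Bool) (T : Set ℕ) (L : ℕ → ℕ)

open scoped Classical in
/-- `stripDist D T L`: the distinguisher `D'` of one-component ciphertext vectors built from a
distinguisher `D` of bare ciphertexts, a set `T` of security parameters and a length bound `L`:
`D'.run x' r = D.run x r` where `⟨x, r⟩ = stripMap ⟨x', r⟩` (so `x = ⟨1ⁿ, c⟩` when
`x' = ⟨1ⁿ, singletonCode c⟩`), and on input length `m = 2n + 2ℓ + 8` with `n ∈ T`, `ℓ ≤ L n`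
(the length of `⟨1ⁿ, singletonCode c⟩`, `|c| = ℓ`) it tosses `D.coinLen (2n + 2 + ℓ)` coins (the
budget of `D` on `⟨1ⁿ, c⟩`); `0` coins on other lengths. When `T` is sparse relative to `L`
(`n + L n < n'` for `n < n'` in `T`) the pair `(n, ℓ)` is determined by `m`
(`stripDist_coinLen`). [Goldreich 2004, proof of Thm. 5.2.11 (first sentence), §5.2.5.1;
Goldreich 2001, §3.2.2] [cite: Goldreich2004, proof of Thm. 5.2.11 (first sentence); §5.2.5.1] -/
noncomputable def stripDist : RandAlg (List Bool) Bool where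
  run x r := Function.uncurry D.run (boolUnpair (stripMap (boolPair x r)))
  coinLen m :=
    if h : ∃ p : ℕ × ℕ, p.1 ∈ T ∧ p.2 ≤ L p.1 ∧ m = 2 * p.1 + 2 * p.2 + 8 then
      D.coinLen (2 * h.choose.1 + 2 + h.choose.2)
    else 0

/-- `D'` runs `D` on the stripped input: `D'.run ⟨1ⁿ, singletonCode c⟩ r = D.run ⟨1ⁿ, c⟩ r`.
[Goldreich 2001, §3.2.2] [cite: Goldreich2001, §3.2.2] -/
theorem stripDist_run (n : ℕ) (c r : List Bool) :
    (stripDist D T L).run (boolPair (unaryEncodeNat n) (singletonCode c)) r =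
      D.run (boolPair (unaryEncodeNat n) c) r := by
  show Function.uncurry D.run (boolUnpair (stripMap _)) = _
  rw [stripMap_boolPair, boolUnpair_boolPair]
  rfl

/-- On a sparse parameter set the coin budget of `D'` on `⟨1ⁿ, singletonCode c⟩` (`n ∈ T`,
`|c| = ℓ ≤ L n`, input length `2n + 2ℓ + 8`) is `D`'s budget on `⟨1ⁿ, c⟩` (length `2n + 2 + ℓ`).
[folklore] -/
theorem stripDist_coinLen (hsep : ∀ n ∈ T, ∀ n' ∈ T, n < n' → n + L n < n') {n ℓ : ℕ}
    (hn : n ∈ T) (hℓ : ℓ ≤ L n) :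
    (stripDist D T L).coinLen (2 * n + 2 * ℓ + 8) = D.coinLen (2 * n + 2 + ℓ) := by
  have hex : ∃ p : ℕ × ℕ, p.1 ∈ T ∧ p.2 ≤ L p.1 ∧ 2 * n + 2 * ℓ + 8 = 2 * p.1 + 2 * p.2 + 8 :=
    ⟨(n, ℓ), hn, hℓ, rfl⟩
  simp only [stripDist]
  rw [dif_pos hex]
  obtain ⟨h1, h2, h3⟩ := hex.choose_spec
  have h4 : hex.choose.1 = n := by
    rcases lt_trichotomy n hex.choose.1 with hlt | heq | hgt
    · have := hsep n hn _ h1 hlt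
      omega
    · exact heq.symm
    · have := hsep _ h1 n hn hgt
      omega
  have h5 : hex.choose.2 = ℓ := by omega
  rw [h4, h5]

/-- `D'` is PPT whenever `D` is: its run function is `uncurry D.run ∘ boolUnpair ∘ stripMap ∘ ⟨·,·⟩`
(composition of polynomial-time maps, `PolyTimeComputable.comp_holds`), and its coin budget is
bounded by `D`'s polynomial (`2n + 2 + ℓ ≤ 2n + 2ℓ + 8`, monotonicity of `ℕ`-polynomials).
[Arora–Barak 2009, §1.3, Thm. 2.8 (proof); Goldreich 2001, §3.2.2] [cite: AroraBarak2009, §1.3] -/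
theorem stripDist_isPPT (hD : IsPPT D encodeBool) : IsPPT (stripDist D T L) encodeBool := by
  refine ⟨?_, ?_⟩
  · have h1 : PolyTimeComputable (fun p : List Bool × List Bool => boolPair p.1 p.2)
        (id : List Bool → List Bool) (fun p : List Bool × List Bool => boolPair p.1 p.2) :=
      PolyTimeComputable.id (fun p : List Bool × List Bool => boolPair p.1 p.2)
    have h2 := PolyTimeComputable.comp_holds polyTimeComputable_stripMap h1
    have h3 := PolyTimeComputable.comp_holds polyTimeComputable_boolUnpair h2
    have h4 : PolyTimeComputable (fun p : List Bool × List Bool => boolPair p.1 p.2) encodeBool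
        (Function.uncurry D.run) := hD.1
    exact PolyTimeComputable.comp_holds h4 h3
  · obtain ⟨p, hp⟩ := hD.2
    refine ⟨p, fun m => ?_⟩
    simp only [stripDist]
    split_ifs with h
    · obtain ⟨_, _, h3⟩ := h.choose_spec
      refine (hp _).trans ?_
      -- evaluation of an `ℕ`-polynomial is monotone in the argument
      have hmono : ∀ (q : Polynomial ℕ) {x y : ℕ}, x ≤ y → q.eval x ≤ q.eval y := by
        intro q x y hxy
        induction q using Polynomial.induction_on' with
        | add p q hp hq => simp only [Polynomial.eval_add]; exact Nat.add_le_add hp hq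
        | monomial n c =>
          simp only [Polynomial.eval_monomial]
          exact Nat.mul_le_mul_left c (Nat.pow_le_pow_left hxy n)
      exact hmono p (by omega)
    · exact Nat.zero_le _

/-- **`D'` simulates `D` exactly on the sparse set**: for `n ∈ T` and `|c| ≤ L n`, the output law
of `D'` on `⟨1ⁿ, singletonCode c⟩` is the output law of `D` on `⟨1ⁿ, c⟩` (same coin count by
`stripDist_coinLen`, same run function by `stripDist_run`). [Goldreich 2001, §3.2.2] [cite: Goldreich2001, §3.2.2] -/
theorem stripDist_outputPMF (hsep : ∀ n ∈ T, ∀ n' ∈ T, n < n' → n + L n < n') {n : ℕ}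
    (hn : n ∈ T) {c : List Bool} (hc : c.length ≤ L n) :
    (stripDist D T L).outputPMF id (boolPair (unaryEncodeNat n) (singletonCode c)) =
      D.outputPMF id (boolPair (unaryEncodeNat n) c) := by
  refine randAlg_outputPMF_congr _ _ _ _ _ _ ?_ fun r => stripDist_run D T L n c r
  have := stripDist_coinLen D T L hsep hn hc
  simp only [id, length_boolPair, length_singletonCode, length_unaryEncodeNat_aux]
  rw [show 2 * n + 2 + (2 * c.length + 6) = 2 * n + 2 * c.length + 8 by omega]
  exact this

/-- Consequently the acceptance law of `D'` on `singletonCode`-re-encoded samples of `X` equals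
that of `D` on `X`, provided `n ∈ T` and the support of `X` obeys the length bound `L n`.
[Goldreich 2001, Def. 3.2.2, §3.2.2] [cite: Goldreich2001, §3.2.2] -/
theorem stripDist_acceptPMF (hsep : ∀ n ∈ T, ∀ n' ∈ T, n < n' → n + L n < n') {n : ℕ}
    (hn : n ∈ T) (X : PMF (List Bool)) (hX : ∀ c ∈ X.support, c.length ≤ L n) :
    acceptPMF (stripDist D T L) n (X.map singletonCode) = acceptPMF D n X := by
  unfold acceptPMF
  rw [PMF.bind_map]
  refine PMF.ext fun b => ?_
  simp only [PMF.bind_apply, Function.comp]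
  refine tsum_congr fun c => ?_
  by_cases hc : c ∈ X.support
  · rw [stripDist_outputPMF D T L hsep hn (hX c hc)]
  · rw [(PMF.apply_eq_zero_iff X c).2 hc, zero_mul, zero_mul]

/-- The distinguishing advantage of `D'` between the re-encoded ensembles equals that of `D`
between the original ones at every `n ∈ T` (supports obeying `L n`). [Goldreich 2001, Def. 3.2.2] [cite: Goldreich2001, Def. 3.2.2] -/
theorem stripDist_distAdvantage (hsep : ∀ n ∈ T, ∀ n' ∈ T, n < n' → n + L n < n')
    (X Y : Ensemble (List Bool)) {n : ℕ} (hn : n ∈ T)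
    (hX : ∀ c ∈ (X n).support, c.length ≤ L n) (hY : ∀ c ∈ (Y n).support, c.length ≤ L n) :
    distAdvantage (stripDist D T L) (fun n => (X n).map singletonCode)
        (fun n => (Y n).map singletonCode) n =
      distAdvantage D X Y n := by
  unfold distAdvantage
  rw [stripDist_acceptPMF D T L hsep hn (X n) hX, stripDist_acceptPMF D T L hsep hn (Y n) hY]

end StripDist

/-! ### Sparse subsequences and finite ciphertext supports -/

/-- `sparseSeq g L`: the sequence `n₀ = g 0`, `nᵢ₊₁ = g (nᵢ + L nᵢ + 1)`; when `a ≤ g a` it is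
strictly increasing with gaps `nᵢ + L nᵢ < nᵢ₊₁`. [folklore] -/
def sparseSeq (g L : ℕ → ℕ) : ℕ → ℕ
  | 0 => g 0
  | i + 1 => g (sparseSeq g L i + L (sparseSeq g L i) + 1)

/-- Every term of `sparseSeq g L` is a value of `g`. [folklore] -/
theorem sparseSeq_forall {g L : ℕ → ℕ} {P : ℕ → Prop} (hP : ∀ a, P (g a)) :
    ∀ i, P (sparseSeq g L i)
  | 0 => hP 0
  | _ + 1 => hP _

/-- `sparseSeq g L` is strictly increasing when `a ≤ g a`. [folklore] -/
theorem sparseSeq_strictMono {g L : ℕ → ℕ} (hg : ∀ a, a ≤ g a) : StrictMono (sparseSeq g L) :=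
  strictMono_nat_of_lt_succ fun i => by
    have := hg (sparseSeq g L i + L (sparseSeq g L i) + 1)
    rw [sparseSeq]
    omega

/-- The gaps of `sparseSeq g L`: `nᵢ + L nᵢ < nⱼ` for `i < j` (when `a ≤ g a`). [folklore] -/
theorem sparseSeq_sep {g L : ℕ → ℕ} (hg : ∀ a, a ≤ g a) {i j : ℕ} (hij : i < j) :
    sparseSeq g L i + L (sparseSeq g L i) < sparseSeq g L j := by
  have h1 : sparseSeq g L (i + 1) ≤ sparseSeq g L j := (sparseSeq_strictMono hg).monotone hij
  have h2 := hg (sparseSeq g L i + L (sparseSeq g L i) + 1)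
  rw [sparseSeq] at h1
  omega

/-- The range of a sparse sequence is a sparse set: `n + L n < n'` for `n < n'` in it. [folklore] -/
theorem sparseSeq_range_sep {g L : ℕ → ℕ} (hg : ∀ a, a ≤ g a) :
    ∀ n ∈ Set.range (sparseSeq g L), ∀ n' ∈ Set.range (sparseSeq g L),
      n < n' → n + L n < n' := by
  rintro _ ⟨i, rfl⟩ _ ⟨j, rfl⟩ hlt
  exact sparseSeq_sep hg ((sparseSeq_strictMono hg).lt_iff_lt.1 hlt)

/-- The output law of a randomized algorithm has finite support (finitely many coin strings).
[Arora–Barak 2009, §7.1] [cite: AroraBarak2009, §7.1] -/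
theorem randAlg_support_outputPMF_finite {α β : Type} (A : RandAlg α β) (ea : α → List Bool)
    (x : α) : (A.outputPMF ea x).support.Finite := by
  unfold RandAlg.outputPMF
  rw [PMF.support_map]
  exact (Set.toFinite _).image _

/-- Ciphertexts of a fixed plaintext at a fixed security parameter have bounded length: the law
`encPMF n m` (`k ← G(1ⁿ); c ← E_k(m)`) has finite support. [Goldreich 2004, Def. 5.1.1,
Def. 5.2.1] [cite: Goldreich2004, Def. 5.2.1] -/
theorem SKEScheme.exists_length_le_of_mem_support (S : SKEScheme) (n : ℕ) (m : List Bool) :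
    ∃ B : ℕ, ∀ c ∈ (S.encPMF n m).support, c.length ≤ B := by
  have hfin : (S.encPMF n m).support.Finite := by
    unfold SKEScheme.encPMF
    rw [PMF.support_bind]
    exact (randAlg_support_outputPMF_finite _ _ _).biUnion fun k _ =>
      randAlg_support_outputPMF_finite _ _ _
  obtain ⟨B, hB⟩ := (hfin.image List.length).bddAbove
  exact ⟨B, fun c hc => hB ⟨c, hc, rfl⟩⟩

/-! ### The discharge -/

namespace SKEScheme

/-- **Discharge of `HasIndMultipleEncryptions.hasIndistinguishableEncryptions`**: indistinguishability
of multiple encryptions implies (single-message) indistinguishability of encryptions. As in the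
source, the single-message game is the `t ≡ 1` case of the multiple-message game
(`multEavAdvantage_singleton`); the H21-specific step from the one-component vector `⟨1¹, ⟨c, ε⟩⟩`
back to the bare ciphertext `c` is the sparse-parameter simulation `stripDist` (module docstring):
if a PPT `D` had non-negligible single-message advantage, `stripDist D T L` (PPT by
`stripDist_isPPT`) would have the same advantage in the `t ≡ 1` game along the infinite sparse
set `T` (`stripDist_distAdvantage`), contradicting `HasIndMultipleEncryptions`.
[Goldreich 2004, proof of Thm. 5.2.11 (first sentence): "multiple-message security implies
single-message security as a special case"; §5.2.5.1 (`t ≡ 1`); Def. 5.2.9] [cite: Goldreich2004, proof of Thm. 5.2.11 (first sentence); §5.2.5.1] -/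
theorem HasIndMultipleEncryptions.hasIndistinguishableEncryptions_holds :
    HasIndMultipleEncryptions.hasIndistinguishableEncryptions := by
  intro S h m₀ m₁ hpoly hlen D hD
  by_contra hnot
  -- (1) a non-negligible advantage: `k`, `ε > 0`, and frequently `ε ≤ nᵏ · adv(n)`
  have hnot' : ¬∀ k : ℕ,
      Tendsto (fun n : ℕ => (n : ℝ) ^ k * eavAdvantage S D m₀ m₁ n) atTop (nhds 0) := hnot
  obtain ⟨k, hk⟩ := not_forall.1 hnot'
  rw [Metric.tendsto_nhds] at hk
  obtain ⟨ε, hε, hfreq⟩ :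
      ∃ ε > 0, ∃ᶠ n : ℕ in atTop, ε ≤ dist ((n : ℝ) ^ k * eavAdvantage S D m₀ m₁ n) 0 := by
    simpa only [not_forall, Classical.not_imp, Filter.not_eventually, not_lt, exists_prop]
      using hk
  choose g hg_ge hg_P using Filter.frequently_atTop.1 hfreq
  -- (2) length bounds on the ciphertext supports
  have hL : ∀ n, ∃ B : ℕ, (∀ c ∈ (S.encPMF n (m₀ n)).support, c.length ≤ B) ∧
      ∀ c ∈ (S.encPMF n (m₁ n)).support, c.length ≤ B := fun n => by
    obtain ⟨B₀, hB₀⟩ := S.exists_length_le_of_mem_support n (m₀ n)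
    obtain ⟨B₁, hB₁⟩ := S.exists_length_le_of_mem_support n (m₁ n)
    exact ⟨max B₀ B₁, fun c hc => (hB₀ c hc).trans (le_max_left _ _),
      fun c hc => (hB₁ c hc).trans (le_max_right _ _)⟩
  choose L hL₀ hL₁ using hL
  -- (3) the sparse set of bad parameters and the distinguisher `D'`
  set φ := sparseSeq g L with hφ
  have hmono : StrictMono φ := sparseSeq_strictMono hg_ge
  have hsep := sparseSeq_range_sep (L := L) hg_ge
  set D' := stripDist D (Set.range φ) L with hD'
  have hD'ppt : IsPPT D' encodeBool := stripDist_isPPT D _ L hD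
  -- (4) `D'` has `D`'s advantage along `T`, contradicting multiple-message security
  have hdecay := HasIndMultipleEncryptions.multEavAdvantage_singleton h hpoly hlen D' hD'ppt
  have hev := Metric.tendsto_nhds.1 (hdecay k) ε hε
  have hfreqT : ∃ᶠ n in atTop, n ∈ Set.range φ :=
    Filter.frequently_atTop.2 fun a => ⟨φ a, hmono.id_le a, a, rfl⟩
  obtain ⟨N, hN_lt, hN_T⟩ := (hev.and_frequently hfreqT).exists
  have heq : multEavAdvantage S D' (fun n => [m₀ n]) (fun n => [m₁ n]) N =
      eavAdvantage S D m₀ m₁ N := by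
    simp only [multEavAdvantage, eavAdvantage, SKEScheme.encVecEnsemble_singleton]
    exact stripDist_distAdvantage D _ L hsep (S.encEnsemble m₀) (S.encEnsemble m₁) hN_T
      (hL₀ N) (hL₁ N)
  rw [heq] at hN_lt
  obtain ⟨i, rfl⟩ := hN_T
  exact absurd hN_lt (not_lt.2 (sparseSeq_forall (L := L) (P := fun b =>
    ε ≤ dist ((b : ℝ) ^ k * eavAdvantage S D m₀ m₁ b) 0) hg_P i))

end SKEScheme

end Literature.Computability.Cryptography
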